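import Summits.ResolutionOfSingularities.ResolutionOfSingularities.Theorems.PurelyInseparableDim4SwapTransportFramedTailSigma
import Summits.ResolutionOfSingularities.ResolutionOfSingularities.Theorems.PurelyInseparableDim4ResConeTwoSlotTailEntrySigma
import HarnessLib
import HarnessLib.Audit.Tags

/-!
# Purely inseparable four-folds — TWO-SLOT POWER-CONE TAIL, CLASS (i) COMPOSITION: a two-slot power-cone tail σ = (n, n) + w (w ≥ 1) in
# T-normal form whose first two charts differ is impossible — every prime, every σ (cell `res-dim4-pi`, K2(p) lane, B rows, row B-LF (iii-b)
# «K24a-PRIME-σ», the composition of transport ∘ entry ∘ δ3; seat res-dim4-p-7 g6)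

[OURS · counted 0 · cell `res-dim4-pi` · K2(p) lane (holder res-dim4-p-12 g5 rulings g5-17/g5-18: three layers — step/α res-dim4-p-1 g6, β/δ res-dim4-p-7 g6,
transport res-dim4-typ-1 g5; ENTRY res-dim4-p-1 g6; «when δ + transport + entry are GREEN: compose»).  COMPOSITION ONLY — every mathematical step is
in the files it imports: TRANSPORT = res-dim4-typ-1 g5 `SwapTransport.framed_play_slot_sigma` (`…SwapTransportFramedTailSigma`, over p-11's
`FrameChange` E1/E2 and typ-1's σ-(VT-f) p719289 / T1); ENTRY = res-dim4-p-1 g6 `FrameChange.twoSlot_entry_frame_sigma` (p720591); GAME = this seat's δ3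
`no_twoSlot_pureCorner_play_of_change_sigma` (over δ1/δ2, β p719195/p719218, p-1's step laws p719168 in p-9's dressing, and res-dim4-p-9 g3's
`CInfGame.Exact.no_infinite_play`).  Seat res-dim4-p-7 g6.]  Nothing here proves K2(7), K2(p), any TAIL(p, d, 3) as filed, `NoIsolatedTrap p p` or
resolution of singularities in dimension ≥ 4 / characteristic `p` — NOT proved: the hypotheses below (witnessed chain ALREADY in T-normal form with slot
charts only and σ-weights at every time, clean start, form carrier off the boundary, first two charts different) are what the lane's earlier structure
theorems (T-sector representation p715478, loss-free stationarity p715775, FT) are to deliver from a real class-(i) tail; that reduction is NOT in this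
file.  AI kernel work, weaker than expert review.

* **`no_twoSlot_powerCone_tail_classI_sigma (p) [Fact p.Prime] [CharP K p] (hσ : n + w + d = p) (hn : 0 < n) (hw : 0 < w) (hd2 : 2 ≤ d)`** — letters
  `x, y` (slots), `v` (passive, weight `w`), `z` (carrier); a witnessed chain `c` with slot charts, clean `c 0`, `z ∉ exc`, boundary `n·x + n·y + w·v` at
  time `0` and σ-shaped at every time, `ord = p + n`, `e_G = 3`, isolated at every time, `x^r ∣ F₀`, power cone `a₀·ℓ^d` at time `0` with `ℓ z ≠ 0`, and
  `j 0 ≠ j 1` ⊢ `False`.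
[cite: CossartJannsenSaito2020, Thm. 3.14] [cite: Hauser2010, §§F–G]
bears_on: LADDER-RESOLUTION:D157-DOOR2 (res-dim4-pi · K2(p) · power cones · K24a-PRIME-σ class (i) composition).  Supports
stmt-ResolutionOfSingularities-16155 (helper).
-/

set_option linter.dupNamespace false -- mandated namespace of this single-conjunct summit

noncomputable section

namespace Summit.ResolutionOfSingularities.ResolutionOfSingularities.Theorems.PIDim4

namespace ResCone

open MvPolynomial Finset
open Literature.AlgebraicGeometry.Resolution
open Literature.AlgebraicGeometry.Resolution.CentreBlowup
open Literature.AlgebraicGeometry.Resolution.Hauser2010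
open Literature.AlgebraicGeometry.Resolution.HauserPerlega2019

variable {K : Type} [Field K] [DecidableEq K]

/-- **NO CLASS-(i) TWO-SLOT POWER-CONE TAIL IN T-NORMAL FORM FROM A LETTER CHANGE, every prime, every σ = (n, n) + w with w ≥ 1** (composition:
res-dim4-typ-1 g5's transport `framed_play_slot_sigma` ∘ res-dim4-p-1 g6's entry frame `twoSlot_entry_frame_sigma` (Tschirnhaus order `N = 2`) ∘ this
seat's δ3 `no_twoSlot_pureCorner_play_of_change_sigma`).  The entry readings of the framed state are read off the clean framed start through the
«off the p-th-power lattice» clause of the transport (every exponent used has `x`-entry in `[1, p − 1]`). [OURS · composition]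
[cite: CossartJannsenSaito2020, Thm. 3.14] -/
theorem no_twoSlot_powerCone_tail_classI_sigma (p : ℕ) [Fact p.Prime] [CharP K p] {n w d : ℕ} (hσ : n + w + d = p) (hn : 0 < n)
    (hw : 0 < w) (hd2 : 2 ≤ d) {x y v z : Fin 4} (hxy : x ≠ y) (hxv : x ≠ v) (hxz : x ≠ z) (hyv : y ≠ v) (hyz : y ≠ z) (hvz : v ≠ z)
    {c : ℕ → State K} {j : ℕ → Fin 4} {β : ℕ → Fin 4 → K} (hwit : FreeTail.IsWitnessedChain p c j β)
    (hclean : deletePthPowers p (c 0).F = (c 0).F) (hslotR : ∀ k, j k = x ∨ j k = y) (hez : z ∉ (c 0).exc)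
    (hr0 : (c 0).r = Finsupp.single x n + Finsupp.single y n + Finsupp.single v w)
    (hσtail : ∀ k, ∃ x' y' v' : Fin 4, x' ≠ y' ∧ x' ≠ v' ∧ y' ≠ v' ∧
      (c k).r = Finsupp.single x' n + Finsupp.single y' n + Finsupp.single v' w)
    (ho : ∀ k, ordZero (c k).F = ((p + n : ℕ) : ℕ∞)) (hdiv0 : ∀ e ∈ (c 0).F.support, (c 0).r ≤ e)
    (he3 : ∀ k, Module.finrank K (resVertex (c k)) = 3) (hiso : ∀ k, IsIsolated p (c k).F)
    {a₀ : K} {ℓ : Fin 4 → K} (ha₀ : a₀ ≠ 0) (hℓz : ℓ z ≠ 0)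
    (hform : resForm (c 0) = C a₀ * (∑ i, C (ℓ i) * X i) ^ d) (hchange : j 0 ≠ j 1) : False := by
  classical
  have hp : p.Prime := Fact.out
  have hdK : (d : K) ≠ 0 := fun h => by
    have hdvd := (CharP.cast_eq_zero_iff K p d).mp h
    have := Nat.le_of_dvd (by omega) hdvd
    omega
  have hrdeg : (c 0).r.degree = 2 * n + w := by
    rw [hr0, map_add, map_add, Finsupp.degree_single, Finsupp.degree_single, Finsupp.degree_single]; ring
  have hrz : (c 0).r z = 0 := by rw [hr0]; simp [hxz.symm, hyz.symm, hvz.symm]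
  have hrx : (c 0).r x = n := by rw [hr0]; simp [hxy, hxv]
  -- (1) ENTRY: p-1's straight Tschirnhaus frame at time 0, order N = 2
  obtain ⟨φ₀, h0, hφ, htschF, -, hcoef, hne, hstr, hjet, -, -, -⟩ :=
    FrameChange.twoSlot_entry_frame_sigma (f := z) p (s := c 0) (o := p + n) (d := d) (by omega) hdK (ho 0) hdiv0
      (by rw [hrdeg]; omega) hrz ha₀ hℓz hform 2
  -- (2) TRANSPORT: typ-1's framed play
  obtain ⟨φ, b, s, -, -, -, -, hrS, hoS, hisoS, he3S, hdivS, hpure, hcoeff0⟩ :=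
    SwapTransport.framed_play_slot_sigma p hσ hn hw (by omega) hxy hxv hxz hyv hyz hvz hwit hclean hslotR hez hr0 hσtail ho hdiv0
      he3 hiso hφ h0
  -- the word: `true` = chart `x`
  set xb : ℕ → Bool := fun k => decide (j k = x) with hxb
  have hchart : ∀ k, (if xb k then x else y) = j k := fun k => by
    rcases hslotR k with h | h
    · simp [hxb, h]
    · simp [hxb, h, hxy.symm]
  -- readings of the framed start, off the `p`-th-power lattice
  have hr0S : (s 0).r = (c 0).r := by rw [hrS 0, hr0]
  have hread : ∀ m : Fin 4 →₀ ℕ, m x + n + 1 ≤ p →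
      coeff ((s 0).r + m) (s 0).F = coeff m (FrameChange.tsch z φ₀ ((c 0).F.divMonomial (c 0).r)) := by
    intro m hmx
    have hnp : ¬ IsPthPowerExponent p ((s 0).r + m) := not_isPthPowerExponent_of_not_dvd (i := x) (by
      rw [Finsupp.add_apply, hr0S, hrx]
      intro hdvd
      have := Nat.le_of_dvd (by omega) hdvd
      omega)
    rw [hcoeff0 _ hnp, hr0S, htschF, coeff_monomial_mul', if_pos le_self_add, one_mul, add_tsub_cancel_left]
  -- (3) GAME: δ3 on the framed play
  refine no_twoSlot_pureCorner_play_of_change_sigma hxy hxv hxz hyv hyz hvz p hσ (by omega) hd2 s xb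
    (fun t hguard => by rw [hchart t]; exact hpure t hguard) (hrS 0) (hdivS 0) hoS he3S hisoS ?_ ?_ ?_ ?_
  · -- `ha0`
    rw [hread _ (by simp [hxz.symm]; omega), hcoef]; exact hne
  · -- `hstraight0`
    intro m hm hmne
    have hmx : m x ≤ d := by
      have := Finsupp.le_degree x m
      omega
    rw [hread _ (by omega)]
    exact hstr m hm hmne
  · -- `htsch0` (Tschirnhaus order 2 at the first chart letter)
    have hκz : (if xb 0 then x else y) ≠ z := by
      rw [hchart 0]
      rcases hslotR 0 with h | h
      · rw [h]; exact hxz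
      · rw [h]; exact hyz
    have hmx : (Finsupp.single z (d - 1) + Finsupp.single (if xb 0 then x else y) 2 : Fin 4 →₀ ℕ) x ≤ 2 := by
      simp only [Finsupp.add_apply, Finsupp.single_apply, if_neg (Ne.symm hxz)]
      split_ifs <;> omega
    rw [hread _ (by omega)]
    refine hjet _ ?_ ?_
    · rw [Finsupp.add_apply, Finsupp.single_eq_same, Finsupp.single_apply, if_neg hκz, add_zero]
    · rw [map_add, Finsupp.degree_single, Finsupp.degree_single]; omega
  · -- the letter change
    intro h01
    apply hchange
    rw [← hchart 0, ← hchart 1, h01]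

end ResCone

end Summit.ResolutionOfSingularities.ResolutionOfSingularities.Theorems.PIDim4

end
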